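import Summits.CriticalPhenomena.SAWScalingLimit.Theses.SAWLeftRightFKG
import Summits.CriticalPhenomena.SAWScalingLimit.Theorems.FKGToTraversalBound.Negative.DeepEndpointGap
import Literature.Probability.RandomPlanarGeometry.CrossingCondition

/-!
# Line `lid-collapse-needle` — skeleton for crux `FKGToTraversalBound` (stmt-CriticalPhenomena-1878)

Crux (route `SAWLeftRightFKG`, rank 3): `FKGToTraversalBound := LeftRightFKG → SAWTraversalBound`
(`Iff.rfl`, Disproof §1 / `Negative.DeepEndpointGap.iff_imp`): left–right positive association (PA) of
the critical square-lattice SAW chord measure in lattice domains `Ω = {z | wind(C, z) ≠ 0}` between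
boundary-adjacent endpoints should give the Aizenman–Burchard hypothesis (H1) for every Dobrushin domain
and every endpoint approximation.

Idea (card `Ideas/lid-collapse-needle.md`, triage r1-1/2/3: pass ×3).  PA is spent ONLY through two
one-sided monotonicities of the hitting probability of a set attached to one boundary arc (triage P3/X3):
(M−) deleting a hull attached to the OPPOSITE arc raises it, (M+) adding material on the SAME side that
keeps the set attached raises it.  Pushed to the extreme, (M−) makes the fully collapsed opposite side
(a `δ`-collar, "squeeze the lid") the worst domain for every unforced pocket dive, the `x_c`-law then
FACTORISES over the beads hanging off the collar, and (M+) shaves the bead to a disc (resp. a shell) with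
ONE lattice spine ("shave the pocket").  So Kemppainen–Smirnov's unforced-crossing bound for the
`x_c`-SAW, one avoidable pocket at a time (`OnePocketBound`, KS arXiv:1212.6215 eq. (3)–(4) with ONE
component of `A^u`, typed with the tree's `unforcedPartZero` / `CurveClass.crossingIn`), reduces to two
clean two-parameter seed families: the spined disc (`NeedleDiveBound`, inward dives; model case = the
card's needle box) and the spined shell (`SpineEscapeBound`, outward excursions, which KS Lemma 3.6
also charges — see the line card, "Triage answers").  Downstream, `OnePocketBound` gives (H1) on the
TAME class of endpoint approximations (both lattice endpoints adjacent to a presenting boundary walk,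
discretisation induced: exactly where `LeftRightFKG` is instantiable, Disproof F3 (R1)) by KS §2.2
(separating arcs: one pocket ⇒ all pockets) + §3 (index lemma 3.6, Prop. 3.5 ⇒ AB) + the exact domain
Markov property; the complementary UNTAME fragment (deep endpoints, wild prime ends — PA uninstantiable
and G2 false there: Disproof F3, triage X1/S1/P1) is isolated as ONE explicitly PA-free stub, the
statement-repair residue every line on this crux carries until the route restates the crux on the tame
class.

`sorry` occurs only in the six `stub_*` theorems; `FKGToTraversalBound_of` concludes the crux BY NAME.
-/

noncomputable section

open MeasureTheory Filter Topology Set Metric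
open scoped NNReal ENNReal
open Literature.Probability.LatticeModels
open Literature.Probability.RandomPlanarGeometry
open Summit.CriticalPhenomena.SAWScalingLimit.Theses.SAWLeftRightFKG
open Summit.CriticalPhenomena.SAWScalingLimit.Theorems.FKGToTraversalBound.Negative (dom lrLE)

namespace Summit.CriticalPhenomena.SAWScalingLimit.Cruxes.FKGToTraversalBound.LidCollapseNeedle

/-! ## Vocabulary: presented lattice domains, sides, attached sets, events -/

/-- `Ω_δ` is a subgraph of `ℤ²`. -/
theorem ddg_le (Ω : Set ℂ) (δ : ℝ) : discreteDomainGraph Ω δ ≤ zdGraph 2 :=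
  (discreteDomainGraph_le_meshGraph Ω δ).trans (meshGraph_le_zdGraph Ω δ)

/-- The presenting closed lattice walk `C` covers its domain SIMPLY and positively: its winding number
takes only the values `0` (outside / on the trace, junk) and `1` (inside).  Every lattice region we meet
(discretised Jordan domains, their slit domains) has such a presentation (trace the boundary of the union
of the open `2δ`-squares around the sites counter-clockwise, slits out and back); multiply covered
presentations (for which side regions degenerate) are excluded. -/
def IsSimplyCovered {c : Site 2} (C : (zdGraph 2).Walk c c) (δ : ℝ) : Prop :=
  ∀ z : ℂ, Literature.Topology.PlaneTopology.wind
      (fun t : ℝ => Set.IccExtend zero_le_one (C.toCurve (meshPoint δ)) t - z) = 0 ∨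
    Literature.Topology.PlaneTopology.wind
      (fun t : ℝ => Set.IccExtend zero_le_one (C.toCurve (meshPoint δ)) t - z) = 1

/-- The chord visits a site of `S`. -/
def hits {Ω : Set ℂ} {δ : ℝ} {a b : Site 2} (S : Set (Site 2)) : Set (SAW.DomainSAW Ω δ a b) :=
  {γ | ∃ s ∈ S, s ∈ γ.walk.support}

/-- The chord visits no site of `H`. -/
def avoids {Ω : Set ℂ} {δ : ℝ} {a b : Site 2} (H : Set (Site 2)) : Set (SAW.DomainSAW Ω δ a b) :=
  {γ | ∀ s ∈ γ.walk.support, s ∉ H}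

/-- TWO-ARC PRESENTATION.  The boundary walk is given as `arc₁ : a' → b'` followed by `arc₂ : b' → a'`
(`C = arc₁ ++ arc₂`, based at `a'`); the chord runs in `Ω = dom (arc₁ ++ arc₂) δ` (verbatim the `Ω` of
`LeftRightFKG`, `Negative.DeepEndpointGap.dom`) from `a ∼ a'` to `b ∼ b'`.  The SIDE LOOP of a chord `γ`
towards `arc₁`: `a' → a`, then `γ`, then `b → b'`, then back along `arc₁` reversed. -/
def sideLoop₁ (δ : ℝ) {a b a' b' : Site 2} (arc₁ : (zdGraph 2).Walk a' b')
    (arc₂ : (zdGraph 2).Walk b' a') (ha : (zdGraph 2).Adj a a') (hb : (zdGraph 2).Adj b b')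
    (γ : SAW.DomainSAW (dom (arc₁.append arc₂) δ) δ a b) : (zdGraph 2).Walk a' a' :=
  SimpleGraph.Walk.cons ha.symm
    ((γ.walk.mapLe (ddg_le _ _)).append (SimpleGraph.Walk.cons hb arc₁.reverse))

/-- The side loop of `γ` towards `arc₂`: `a' → a`, `γ`, `b → b'`, then along `arc₂`. -/
def sideLoop₂ (δ : ℝ) {a b a' b' : Site 2} (arc₁ : (zdGraph 2).Walk a' b')
    (arc₂ : (zdGraph 2).Walk b' a') (ha : (zdGraph 2).Adj a a') (hb : (zdGraph 2).Adj b b')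
    (γ : SAW.DomainSAW (dom (arc₁.append arc₂) δ) δ a b) : (zdGraph 2).Walk a' a' :=
  SimpleGraph.Walk.cons ha.symm
    ((γ.walk.mapLe (ddg_le _ _)).append (SimpleGraph.Walk.cons hb arc₂))

/-- The region between the chord `γ` and `arc₁` (non-zero winding of the side loop; the lattice form
of the "right region" whose nesting is the route's order `≼`). -/
def sideRegion₁ (δ : ℝ) {a b a' b' : Site 2} (arc₁ : (zdGraph 2).Walk a' b')
    (arc₂ : (zdGraph 2).Walk b' a') (ha : (zdGraph 2).Adj a a') (hb : (zdGraph 2).Adj b b')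
    (γ : SAW.DomainSAW (dom (arc₁.append arc₂) δ) δ a b) : Set ℂ :=
  dom (sideLoop₁ δ arc₁ arc₂ ha hb γ) δ

/-- The region between the chord `γ` and `arc₂`. -/
def sideRegion₂ (δ : ℝ) {a b a' b' : Site 2} (arc₁ : (zdGraph 2).Walk a' b')
    (arc₂ : (zdGraph 2).Walk b' a') (ha : (zdGraph 2).Adj a a') (hb : (zdGraph 2).Adj b b')
    (γ : SAW.DomainSAW (dom (arc₁.append arc₂) δ) δ a b) : Set ℂ :=
  dom (sideLoop₂ δ arc₁ arc₂ ha hb γ) δ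

/-- A site set `S` is ATTACHED to a side (given by the side-region map of that arc) when every chord
either visits `S` or leaves all of `S` strictly inside its region on that side — the slit-safe meaning of
"`S` hangs off that boundary arc" (a pocket off one bank of a slit is attached to that bank's arc only,
although both banks share their vertices). -/
def Attached {Ω : Set ℂ} {δ : ℝ} {a b : Site 2} (region : SAW.DomainSAW Ω δ a b → Set ℂ)
    (S : Set (Site 2)) : Prop :=
  ∀ γ : SAW.DomainSAW Ω δ a b, (∃ s ∈ S, s ∈ γ.walk.support) ∨ ∀ s ∈ S, meshPoint δ s ∈ region γ

/-! ## Statements of the line -/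

/-- **One-sided monotonicities (M−)/(M+)** — the ONLY form in which the line consumes PA (triage X3:
`Sandwich` = `CarveCore` = this).  In a simply covered two-arc presentation, for a set `S` attached to
`arc₂`: (M−) avoiding a set `H` attached to the OPPOSITE arc is positively correlated with hitting `S`
(so by exact restriction `P_{Ω∖H}(hit S) ≥ P_Ω(hit S)`: carving the opposite side raises the dive
probability, the fully collapsed lid is the worst case — card N1 `SlotCollapseMono`, 8 families, 0
violations; triage re-derivations); (M+) avoiding a set attached to the SAME arc is negatively
correlated with hitting `S` (so `P_Ω(hit S) ≤ P_{Ω∪H}(hit S)` when `S` stays attached: enlarging /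
shaving the pocket side raises it — card `FlaskEnlargeMono`, +18–31 %).  Content beyond `LeftRightFKG`:
`hit S` / `avoid H` are `≼`-monotone of the stated types (winding additivity `wind(side loop γ₁) −
wind(side loop γ₂) = wind(lens γ₁γ₂⁻¹)` off the traces, jump of `wind` across a simply traversed edge),
plus inclusion–exclusion on the finite weights for the negative correlation. -/
def OneSidedMono : Prop :=
  ∀ (δ : ℝ) (a b a' b' : Site 2) (arc₁ : (zdGraph 2).Walk a' b') (arc₂ : (zdGraph 2).Walk b' a')
    (ha : (zdGraph 2).Adj a a') (hb : (zdGraph 2).Adj b b'), 0 < δ →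
    IsSimplyCovered (arc₁.append arc₂) δ →
    ∀ S H : Set (Site 2), Attached (sideRegion₂ δ arc₁ arc₂ ha hb) S →
      (Attached (sideRegion₁ δ arc₁ arc₂ ha hb) H →
        SAW.weight (dom (arc₁.append arc₂) δ) δ a b (hits S) *
            SAW.weight (dom (arc₁.append arc₂) δ) δ a b (avoids H) ≤
          SAW.weight (dom (arc₁.append arc₂) δ) δ a b (hits S ∩ avoids H) *
            SAW.weight (dom (arc₁.append arc₂) δ) δ a b Set.univ) ∧
      (Attached (sideRegion₂ δ arc₁ arc₂ ha hb) H →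
        SAW.weight (dom (arc₁.append arc₂) δ) δ a b (hits S ∩ avoids H) *
            SAW.weight (dom (arc₁.append arc₂) δ) δ a b Set.univ ≤
          SAW.weight (dom (arc₁.append arc₂) δ) δ a b (hits S) *
            SAW.weight (dom (arc₁.append arc₂) δ) δ a b (avoids H))

/-- **Needle-dive bound** (seed 1, INWARD normal form = the card's `SpinedDiskNonDegeneracy` with the
spine and the outside geometry quantified explicitly, triage sharpenings r1-1/2/3).  For every `ε > 0`
there is a ratio `C₀` such that: in every simply covered presented domain whose intersection with the
open disc `B(z₀, R)` is the disc minus the trace of ONE lattice path (the spine; everything outside the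
disc — lid, pockets, far walls, the pinning of the chord at any two boundary-adjacent sites outside the
disc — is arbitrary), if the chord can join its ends avoiding the closed inner disc `B̄(z₀, r)`,
`R ≥ C₀ r ≥ C₀ δ`, then it visits `B̄(z₀, r)` with probability `≤ ε`.  Conformal prediction
`≍ (r/R)^{β}`, `β = 1` for the straight needle (two legs at a `2π`-wedge tip); the straight needle with
the lid collapsed onto the rim is the conjectured extremal spine (model case: the card's
`NeedleNonDegeneracy`, data N2/N3: dive ratio `1.8 → 1.25 %` at depth = width, `w = 2…5`).  FALSE for
`x > x_c` (space-filling phase): any proof spends criticality.  Open; RSW-type content of the line. -/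
def NeedleDiveBound : Prop :=
  ∀ ε : ℝ, 0 < ε → ∃ C₀ : ℝ, 1 < C₀ ∧
    ∀ (δ : ℝ) (a b a' b' : Site 2) (arc₁ : (zdGraph 2).Walk a' b') (arc₂ : (zdGraph 2).Walk b' a')
      (z₀ : ℂ) (r R : ℝ) (u v : Site 2) (σ : (zdGraph 2).Walk u v),
      0 < δ → δ ≤ r → C₀ * r ≤ R → (zdGraph 2).Adj a a' → (zdGraph 2).Adj b b' →
      IsSimplyCovered (arc₁.append arc₂) δ → σ.IsPath →
      meshPoint δ a ∉ Metric.ball z₀ R → meshPoint δ b ∉ Metric.ball z₀ R →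
      dom (arc₁.append arc₂) δ ∩ Metric.ball z₀ R =
        Metric.ball z₀ R \ Set.range (σ.toCurve (meshPoint δ)) →
      JoinedIn (dom (arc₁.append arc₂) δ \ Metric.closedBall z₀ r) (meshPoint δ a) (meshPoint δ b) →
      SAW.law (dom (arc₁.append arc₂) δ) δ a b
          {γ | ∃ s ∈ γ.walk.support, meshPoint δ s ∈ Metric.closedBall z₀ r} ≤ ENNReal.ofReal ε

/-- **Spine-escape bound** (seed 2, OUTWARD normal form; the card's "outward dives stay rough-bead
statements" made clean by keeping a spine to the far boundary so that the target circle stays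
attached).  For every `ε > 0` there is `C₀` such that: in every simply covered presented domain which,
in some shell `B(z₀, R') ∖ B̄(z₀, r)` with `R' ≥ R`, is the shell minus the trace of ONE lattice path
(inside `B̄(z₀, r)` — lid, pins, walls — and beyond `R'` everything is arbitrary), a chord pinned at two
sites of `B̄(z₀, r)` that can be joined inside `B(z₀, R)` reaches distance `R ≥ C₀ r ≥ C₀ δ` from `z₀`
with probability `≤ ε` (two critical legs across the shell and back: a rooted-arch tail; slit-plane
limit as `R' → ∞` is the worst case by (M+)).  Open; same status as seed 1. -/
def SpineEscapeBound : Prop :=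
  ∀ ε : ℝ, 0 < ε → ∃ C₀ : ℝ, 1 < C₀ ∧
    ∀ (δ : ℝ) (a b a' b' : Site 2) (arc₁ : (zdGraph 2).Walk a' b') (arc₂ : (zdGraph 2).Walk b' a')
      (z₀ : ℂ) (r R R' : ℝ) (u v : Site 2) (σ : (zdGraph 2).Walk u v),
      0 < δ → δ ≤ r → C₀ * r ≤ R → R ≤ R' → (zdGraph 2).Adj a a' → (zdGraph 2).Adj b b' →
      IsSimplyCovered (arc₁.append arc₂) δ → σ.IsPath →
      meshPoint δ a ∈ Metric.closedBall z₀ r → meshPoint δ b ∈ Metric.closedBall z₀ r →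
      dom (arc₁.append arc₂) δ ∩ (Metric.ball z₀ R' \ Metric.closedBall z₀ r) =
        (Metric.ball z₀ R' \ Metric.closedBall z₀ r) \ Set.range (σ.toCurve (meshPoint δ)) →
      JoinedIn (dom (arc₁.append arc₂) δ ∩ Metric.ball z₀ R) (meshPoint δ a) (meshPoint δ b) →
      SAW.law (dom (arc₁.append arc₂) δ) δ a b
          {γ | ∃ s ∈ γ.walk.support, R ≤ dist (meshPoint δ s) z₀} ≤ ENNReal.ofReal ε

/-- **One-pocket bound** — Kemppainen–Smirnov's unforced-crossing bound at time zero for the critical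
SAW in every simply covered presented domain (slits allowed: by the SAW's exact domain Markov property
this family contains every conditioned future, KS Remark 2.8 / §4.1.6), ONE AVOIDABLE COMPONENT AT A
TIME: there is `C₀ > 1` such that for `R ≥ C₀ r ≥ C₀ δ` and every point `z` of the avoidable set `A^u`
(`unforcedPartZero`, KS eq. (3): the component `W` of `z` in `Ω ∩ A(z₀, r, R)` does not disconnect `δa`
from `δb`, and `∂B(z₀, r)` meets `∂Ω`), the chord's polyline makes a crossing of the annulus inside `W`
(`CurveClass.crossingIn`, either orientation) with probability `≤ 1/2`.  KS's Condition G1 (eq. (4)) is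
the same bound for all components simultaneously (Remark 1.2); the passage one ⇒ all is KS §2.2 and sits
in `stub_pocketToTame`.  The target of the collapse reduction. -/
def OnePocketBound : Prop :=
  ∃ C₀ : ℝ, 1 < C₀ ∧ ∀ (δ : ℝ) (a b a' b' : Site 2) (arc₁ : (zdGraph 2).Walk a' b')
    (arc₂ : (zdGraph 2).Walk b' a') (z₀ z : ℂ) (r R : ℝ),
    0 < δ → δ ≤ r → C₀ * r ≤ R → (zdGraph 2).Adj a a' → (zdGraph 2).Adj b b' →
    IsSimplyCovered (arc₁.append arc₂) δ →
    z ∈ unforcedPartZero (dom (arc₁.append arc₂) δ) (meshPoint δ a) (meshPoint δ b) z₀ r R →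
    SAW.law (dom (arc₁.append arc₂) δ) δ a b
        {γ | γ.curve ∈ CurveClass.crossingIn z₀ r R
          (connectedComponentIn (dom (arc₁.append arc₂) δ ∩ planarAnnulus z₀ r R) z)} ≤ 2⁻¹

/-- **Tame endpoint approximations** — exactly where `LeftRightFKG` can be instantiated along the whole
exploration (Disproof F3, repair class (R1)): eventually in `δ`, the discretisation `Ω_δ` of the
Dobrushin domain IS (as a graph) the discretisation of a simply covered presented lattice domain whose
boundary walk passes next to both lattice endpoints.  Deep endpoints (`exists_isEndpointApprox_deepStart`)
and meshes at which `discreteDomainGraph D.carrier δ` drops edges across sub-mesh exterior fjords (F3 (c))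
are untame. -/
def TameApprox (D : DobrushinDomain) (a b : ℝ → Site 2) : Prop :=
  ∀ᶠ δ in 𝓝[>] (0 : ℝ), ∃ (a' b' : Site 2) (arc₁ : (zdGraph 2).Walk a' b')
    (arc₂ : (zdGraph 2).Walk b' a'),
    (zdGraph 2).Adj (a δ) a' ∧ (zdGraph 2).Adj (b δ) b' ∧ IsSimplyCovered (arc₁.append arc₂) δ ∧
      discreteDomainGraph D.carrier δ = discreteDomainGraph (dom (arc₁.append arc₂) δ) δ

/-- (H1) — the route's `SAWTraversalBound`, verbatim — restricted to TAME endpoint approximations. -/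
def TameTraversalBound : Prop :=
  ∀ (D : DobrushinDomain) (a b : ℝ → Site 2), SAW.IsEndpointApprox D a b → TameApprox D a b →
    ∃ (k : ℂ → ℝ → ℝ → ℕ) (K lam δ₀ : ℝ), 0 ≤ K ∧ 2 < lam ∧ 0 < δ₀ ∧ ∀ δ ∈ Set.Ioc (0 : ℝ) δ₀,
      ∀ (x : ℂ) (ρ R : ℝ), δ ≤ ρ → ρ < R → R ≤ 1 →
        SAW.law D.carrier δ (a δ) (b δ)
            {γ | (⟨γ.walk.toCurve (meshPoint δ)⟩ : Curve ℂ).HasTraversals (k x ρ R) x ρ R}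
          ≤ ENNReal.ofReal (K * (ρ / R) ^ lam)

/-- (H1) on the complementary UNTAME fragment (deep endpoints; wild prime ends).  Statement-repair
residue, NOT this line's mechanism: PA is uninstantiable there (`not_presentable_of_enclosed`,
`not_PAClause_weight_of_two_maximal`) and the uniform-in-past engine is false there (triage X1/S1: ring
pasts give unforced crossings of conditional probability → 1), so this fragment needs an averaged /
radial return estimate for the critical SAW near a deep start — or disappears when the route restates
`FKGToTraversalBound` on `TameApprox` (Disproof (R1); DCS12 take the CLOSEST vertices). -/
def UntameTraversalBound : Prop :=
  ∀ (D : DobrushinDomain) (a b : ℝ → Site 2), SAW.IsEndpointApprox D a b → ¬ TameApprox D a b →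
    ∃ (k : ℂ → ℝ → ℝ → ℕ) (K lam δ₀ : ℝ), 0 ≤ K ∧ 2 < lam ∧ 0 < δ₀ ∧ ∀ δ ∈ Set.Ioc (0 : ℝ) δ₀,
      ∀ (x : ℂ) (ρ R : ℝ), δ ≤ ρ → ρ < R → R ≤ 1 →
        SAW.law D.carrier δ (a δ) (b δ)
            {γ | (⟨γ.walk.toCurve (meshPoint δ)⟩ : Curve ℂ).HasTraversals (k x ρ R) x ρ R}
          ≤ ENNReal.ofReal (K * (ρ / R) ^ lam)

/-! ## Stubs (registered; `sorry` only here) -/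

/-- STUB 1 (M; provable now) — PA ⇒ the two one-sided monotonicities.  `LeftRightFKG` is used HERE and
nowhere else (Disproof F1 `mono_hyp` with `P := OneSidedMono`). -/
theorem stub_oneSidedMono : LeftRightFKG → OneSidedMono := by
  sorry

/-- STUB 2 (L; the idea, load-bearing) — COLLAPSE / FACTORISE / SHAVE.  For an avoidable component `W`
of `Ω ∩ A` (it touches at most one boundary arc `σ`, free-loop / KS Def. 2.2; interior annuli are
exempt): a crossing inside `W` hits `W`'s far mouth, a `σ`-attached set; (M−) with `H :=` everything on
the `σ'`-side except a `δ`-collar along `σ` outside `W`'s pocket gives the skeletal domain EXACTLY (sup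
over domains = sup over skeletal ones, which are slit domains again); the `x_c`-law factorises over the
beads hanging off the collar (self-avoidance couples only inside one bead), so the bead of `W` — pocket
+ lid, chord pinned at the lid's ends — carries the event alone; (M+) merges `W`'s mouths into one lid
and shaves the bead to the disc minus one spine `σ* ⊂` old wall (inward crossings; extremal-length
monotonicity keeps `log(R/r)/2π`, KS Lemma 2.11) resp. to the shell minus one spine (outward
crossings); the two seeds with `ε = 1/4` bound the two orientations.  Lattice topology of `Attached`
for mouths / hulls and the restriction identity `P_{Ω∖H} = P_Ω(· | avoid H)` live here. -/
theorem stub_collapse : OneSidedMono → NeedleDiveBound → SpineEscapeBound → OnePocketBound := by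
  sorry

/-- STUB 3 (L–XL; open, HARDEST — the metric input; cheapest falsifier family = straight needle,
collapsed lid: transfer matrix / pivot sampling `n = 8…40`, card "Cheapest falsifier" (b)). -/
theorem stub_needleDive : NeedleDiveBound := by
  sorry

/-- STUB 4 (L; open, the outward twin of STUB 3; falsifier family = chord pinned at `(±1, 0)` in the box
`(-L, L)²` slit along `{0} × [1, L]`, event "reach sup-distance `n`", `L ≫ n`). -/
theorem stub_spineEscape : SpineEscapeBound := by
  sorry

/-- STUB 5 (XL, charted: Kemppainen–Smirnov plumbing, model-free given the exact domain Markov property)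
— one pocket ⇒ (H1) on the tame class: (i) the presented family is stable under conditioning on an
initial segment explored from `a_δ` (splice the past into the boundary walk through `a'`; tip and target
stay adjacent; Disproof F3 / `noFloatingHoles`), and the law of `SAW.law D.carrier δ` is transported to
the presentation by the graph identity in `TameApprox`; (ii) chaining `OnePocketBound` along a pocket
(DMP at the successive mouths) gives the exponential one-pocket bound, and KS §2.2 (separating arcs,
Jensen; arXiv:1212.6215 pp. 11–12) turns it into the all-components annulus bound G2 with stopping
times; (iii) KS §3 (index `I(A, D_τ)`, Lemma 3.6: an index increase of `2n−1` costs `2n−1` unforced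
crossings of the three concentric thirds; proof of Prop. 3.5 = "cond ⇒ aizbur") gives (H1) with the
shell-dependent threshold absorbing the finitely many crossings of the shell forced by `∂D`
(`Curve.exists_not_hasTraversals`) — tree templates `fkInterface_traversalBound_of_annulusCrossing_le`,
`Percolation.bondExploration_traversalBound_holds`. -/
theorem stub_pocketToTame : OnePocketBound → TameTraversalBound := by
  sorry

/-- STUB 6 (open; NOT this line's mechanism — statement-repair residue shared by every line on this crux,
Disproof (R1), triage P1/S1/S2/X1) — (H1) for endpoint approximations that are not eventually tame. -/
theorem stub_untameFragment : UntameTraversalBound := by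
  sorry

/-! ## Composition (sorry-free) -/

/-- (H1) is the conjunction of its tame and untame halves. -/
theorem traversalBound_of_tame_untame (hT : TameTraversalBound) (hU : UntameTraversalBound) :
    SAWTraversalBound := by
  intro D a b hab
  by_cases ht : TameApprox D a b
  · exact hT D a b hab ht
  · exact hU D a b hab ht

/-- **`FKGToTraversalBound` from the stubs.**  PA enters through STUB 1 only; the collapse reduction
(STUB 2) turns the two clean seeds (STUBS 3–4) into the one-pocket bound; KS plumbing (STUB 5) gives
(H1) on the tame class; STUB 6 is the untame residue; the proved split assembles `SAWTraversalBound`,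
which is the crux's consequent (`FKGToTraversalBound` unfolds to `LeftRightFKG → SAWTraversalBound`). -/
theorem FKGToTraversalBound_of : FKGToTraversalBound := fun hPA =>
  traversalBound_of_tame_untame
    (stub_pocketToTame (stub_collapse (stub_oneSidedMono hPA) stub_needleDive stub_spineEscape))
    stub_untameFragment

end Summit.CriticalPhenomena.SAWScalingLimit.Cruxes.FKGToTraversalBound.LidCollapseNeedle

end
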